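import Summits.Langlands.Langlands.Theses.EllipticTraceSplit

/-!
# Route EllipticTraceSplit — Assembly

The assembly item (stmt-Langlands-27587) of the child route `EllipticTraceSplit` (decomp-langlands lens-2 gen 19, REV 1; a gate-native D-0170
refining child: `--refines route-Langlands-SymmetryTypeSplit:GenericProModular`, edge split, depth 2) for the declared residual
GEN = `SymmetryTypeSplit.GenericProModular` (stmt-Langlands-27289):
`EllipticGenericProModular → NonEllipticGenericProModular → SymmetryTypeSplit.GenericProModular`.

This is literally the type of the route file's sorry-free deciding theorem `Summit.Langlands.Langlands.Theses.EllipticTraceSplit.closes`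
(one `Classical.byCases` on the twist-saturated elliptic-trace box EBOX(F,p,ρ), inferred from the cells' binders).  Nothing here proves
`Langlands` (nor GEN): the assembly records only that the two cell items of the route, taken together, imply the parent residual by name.
-/

set_option linter.dupNamespace false -- project-wide option (lakefile weak.linter.dupNamespace); `Summit.Langlands.Langlands` is the mandated namespace

namespace Summit.Langlands.Langlands.Theorems

/-- **Assembly of route EllipticTraceSplit** (stmt-Langlands-27587): `ELL → NEL → SymmetryTypeSplit.GenericProModular`.
Proof: unfold `Assembly` and apply the route's deciding theorem `Theses.EllipticTraceSplit.closes`. -/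
theorem ellipticTraceSplit_assembly_proof :
    Summit.Langlands.Langlands.Theses.EllipticTraceSplit.Assembly := by
  unfold Summit.Langlands.Langlands.Theses.EllipticTraceSplit.Assembly
  exact Summit.Langlands.Langlands.Theses.EllipticTraceSplit.closes

end Summit.Langlands.Langlands.Theorems
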